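import Mathlib
import Literature.RingTheory.CohomologyAnnihilator.Basic
import Summits.ResolutionOfSingularities.ResolutionOfSingularities.Theses.HomologicalConductor
import Summits.ResolutionOfSingularities.ResolutionOfSingularities.Theorems.HomologicalConductorNoZenoBirthDefs
import Summits.ResolutionOfSingularities.ResolutionOfSingularities.Theorems.HomologicalConductorNoZenoTowerNoetherian
import Summits.ResolutionOfSingularities.ResolutionOfSingularities.Theorems.HomologicalConductorNoZenoNoetherianCase
import Summits.ResolutionOfSingularities.ResolutionOfSingularities.Theorems.SyzygyFlatteningHigherRankTerminationNrmLocAt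
import HarnessLib

/-!
# `StrictDrop` (stmt-ResolutionOfSingularities-16485) is false as soon as a SELF-SIMILAR SEED exists

Route `ResolutionOfSingularities/HomologicalConductor`, crux #4 `StrictDrop`: along the canonical
normalised cohomology-annihilator blow-up tower `T₀ = loc A`, `T_(m+1) = loc (nrm (chart T_m))`
of a finitely generated `A ⊆ O ⊆ K = Frac A` (`O` a valuation ring of `K ⊇ k`), while `T_m` is
singular some later stage carries a non-zero annihilator of value strictly below all of
`ca(T_m) ∖ 0`.

This file proves the NEGATIVE LEMMA (`¬ StrictDrop` modulo a construction)

* `StrictDrop_false_of_SelfSimilarSeed` — if there is a **self-similar seed** (`SelfSimilarSeed`): crux data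
  `(p, k, K, O, A)` together with a `k`-automorphism `σ` of `K` that preserves `O`
  (`σ z ∈ O ↔ z ∈ O`) and does not decrease values on `O` (`σ z · z⁻¹ ∈ O` for `0 ≠ z ∈ O`;
  automatic when `O` is a DVR), and a SINGULAR stage `T_s` whose successor is its `σ`-translate,
  `T_(s+1) = σ(T_s)`, then `StrictDrop` fails.

Mechanism (all proved here, no computation of any annihilator is needed):

1. **`ca` is intrinsic** (`map_mem_cohomologyAnnihilatorOfDegree`, `ca_map`): a ring isomorphism
   transports the Iyengar–Takahashi annihilator ideals — restriction of scalars along it is an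
   exact fully faithful functor preserving projectives, hence injective on Mathlib's `Ext`
   (`Functor.mapExt_bijective_of_preservesProjectiveObjects`), and it turns the homothety `σ x`
   into the homothety `x`. So `ca(σ T) = σ(ca T)`.
2. **The tower step is `σ`-equivariant** for `σ` preserving `O` (`loc_map_le`, `chart_map_le`,
   `nrm_map_le`, `step_map`): `loc`, `chart`, `nrm` are defined from `T`, `ca T`, integrality and
   membership in `O` only.
3. Hence `T_(s+n+1) = σ(T_(s+n))` for all `n` (`tower_add_succ`), every non-zero
   `y ∈ ca(T_(s+n))` is `σⁿ(x)` for a non-zero `x ∈ ca(T_s)` with `y · x⁻¹ ∈ O`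
   (`exists_mem_ca_base`), and the drop demanded by `StrictDrop` at the singular stage `s`
   (`y · x⁻¹ ∉ O` for ALL non-zero `x ∈ ca(T_s)`) is impossible.

The seed is exactly the shape of the known loops of canonical blow-up procedures (a chart of the
normalised Nash blow-up of a toric fourfold is isomorphic to the original cone, Castillo–Duarte–
Leyton-Álvarez–Liendo 2024, via a lattice automorphism `σ`; an eigen-weight valuation is
`σ`-stable), transposed to the `ca`-tower; whether a seed EXISTS for the cohomology annihilator is
the open construction this lemma isolates (one normalised `ca`-blow-up of one singularity, not an
infinite tower). The seed is the one definition of this file (`SelfSimilarSeed`, stated over the route's `let`-telescope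
verbatim), filed by the gate as a construction item.
-/

noncomputable section

-- single-problem summit: the doubled namespace component is forced
set_option linter.dupNamespace false

open CategoryTheory CategoryTheory.Abelian Literature.RingTheory.CohomologyAnnihilator
open Summit.ResolutionOfSingularities.ResolutionOfSingularities.Theses.HomologicalConductor (StrictDrop)

namespace Summit.ResolutionOfSingularities.ResolutionOfSingularities.Theorems.StrictDrop.Negative.SelfSimilar

/-! ## 1. The cohomology annihilator is intrinsic: transport along a ring isomorphism -/

section Transport

universe u

variable {R S : Type u} [CommRing R] [CommRing S]

/-- Restriction of scalars along a SURJECTIVE ring map preserves finite generation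
(`S` is then a cyclic `R`-module and finiteness is transitive). [folklore] -/
theorem finite_restrictScalars_of_surjective (f : R →+* S) (hf : Function.Surjective f)
    (M : ModuleCat.{u} S) [Module.Finite S M] :
    Module.Finite R ((ModuleCat.restrictScalars f).obj M) := by
  set M' : ModuleCat.{u} R := (ModuleCat.restrictScalars f).obj M
  letI : Algebra R S := f.toAlgebra
  haveI : Module.Finite R S := Module.Finite.of_surjective (Algebra.linearMap R S) hf
  haveI : Module.Finite S M' := ‹Module.Finite S M›
  haveI : IsScalarTower R S M' :=
    ⟨fun r s m => show (f r * s) • (show M from m) = f r • (s • show M from m) from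
      mul_smul (f r) s (show M from m)⟩
  exact Module.Finite.trans S M'

/-- **The cohomology annihilator is intrinsic**: a ring isomorphism `e : R ≃+* S` maps `caⁿ(R)`
into `caⁿ(S)`. Restriction of scalars along `e` is an exact, fully faithful functor
`ModuleCat S ⥤ ModuleCat R` preserving projectives and finite generation, so it is injective on
`Ext` (Mathlib's `Functor.mapExt_bijective_of_preservesProjectiveObjects`), and it turns the
homothety `e x` on an `S`-module into the homothety `x`. [folklore] -/
theorem map_mem_cohomologyAnnihilatorOfDegree (e : R ≃+* S) {n : ℕ} {x : R}
    (hx : x ∈ cohomologyAnnihilatorOfDegree R n) : e x ∈ cohomologyAnnihilatorOfDegree S n := by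
  rw [mem_cohomologyAnnihilatorOfDegree_iff] at hx ⊢
  intro i hi M N hM hN ε
  let G : ModuleCat.{u} S ⥤ ModuleCat.{u} R := ModuleCat.restrictScalars e.toRingHom
  haveI : G.IsEquivalence := ModuleCat.restrictScalars_isEquivalence_of_ringEquiv e
  haveI : Module.Finite R (G.obj M) := finite_restrictScalars_of_surjective e.toRingHom e.surjective M
  haveI : Module.Finite R (G.obj N) := finite_restrictScalars_of_surjective e.toRingHom e.surjective N
  have hinj : Function.Injective (G.mapExtAddHom M N i) :=
    (G.mapExt_bijective_of_preservesProjectiveObjects M N i).1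
  apply hinj
  rw [map_zero, Functor.mapExtAddHom_apply, Ext.smul_eq_comp_mk₀, Ext.mapExactFunctor_comp,
    Ext.mapExactFunctor_mk₀]
  have hmap : G.map (e x • 𝟙 N) = x • 𝟙 (G.obj N) := by
    ext m
    rfl
  rw [hmap, ← Ext.smul_eq_comp_mk₀]
  exact hx i hi (G.obj M) (G.obj N) inferInstance inferInstance _

/-- A ring isomorphism maps `ca(R)` into `ca(S)`. [folklore] -/
theorem map_mem_cohomologyAnnihilator (e : R ≃+* S) {x : R} (hx : x ∈ cohomologyAnnihilator R) :
    e x ∈ cohomologyAnnihilator S := by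
  rw [mem_cohomologyAnnihilator_iff] at hx ⊢
  obtain ⟨n, hn⟩ := hx
  exact ⟨n, map_mem_cohomologyAnnihilatorOfDegree e hn⟩

end Transport

/-! ## 2. Equivariance of the tower operator under an `O`-preserving automorphism of `K` -/

section Equivariance

open Summit.ResolutionOfSingularities.ResolutionOfSingularities.Theorems.NoZeno.Birth
  (ca loc chart nrm tower tower_zero tower_succ mem_ca_iff ca_subset tn_coe_mem_ca_iff
    mem_valuationSubring_of_mem_tower)

variable {k K : Type} [Field k] [Field K] [Algebra k K]

/-- `σ(ca T) ⊆ ca(σ T)` for a `k`-automorphism `σ` of `K` (transport along `T ≃ σ T`). [folklore] -/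
theorem image_ca_subset (σ : K ≃ₐ[k] K) (T : Subalgebra k K) :
    σ '' ca T ⊆ ca (T.map (σ : K →ₐ[k] K)) := by
  rintro _ ⟨x, hx, rfl⟩
  have hxT : x ∈ T := ca_subset T hx
  have hca : (⟨x, hxT⟩ : ↥T) ∈ cohomologyAnnihilator ↥T := (tn_coe_mem_ca_iff T ⟨x, hxT⟩).mp hx
  let e : ↥T ≃ₐ[k] ↥(T.map (σ : K →ₐ[k] K)) := σ.subalgebraMap T
  have h := map_mem_cohomologyAnnihilator e.toRingEquiv hca
  have hcoe : ((e.toRingEquiv ⟨x, hxT⟩ : ↥(T.map (σ : K →ₐ[k] K))) : K) = σ x := rfl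
  rw [← hcoe]
  exact (tn_coe_mem_ca_iff _ _).mpr h

/-- `(σ T).map σ⁻¹ = T`. [folklore] -/
theorem map_map_symm (σ : K ≃ₐ[k] K) (T : Subalgebra k K) :
    (T.map (σ : K →ₐ[k] K)).map (σ.symm : K →ₐ[k] K) = T := by
  rw [Subalgebra.map_map, AlgEquiv.symm_comp, Subalgebra.map_id]

/-- `(σ⁻¹ T).map σ = T`. [folklore] -/
theorem map_symm_map (σ : K ≃ₐ[k] K) (T : Subalgebra k K) :
    (T.map (σ.symm : K →ₐ[k] K)).map (σ : K →ₐ[k] K) = T := by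
  simpa using map_map_symm σ.symm T

/-- **`ca(σ T) = σ(ca T)`.** [folklore] -/
theorem ca_map (σ : K ≃ₐ[k] K) (T : Subalgebra k K) :
    ca (T.map (σ : K →ₐ[k] K)) = σ '' ca T := by
  refine Set.Subset.antisymm ?_ (image_ca_subset σ T)
  intro y hy
  have h := image_ca_subset σ.symm (T.map (σ : K →ₐ[k] K)) ⟨y, hy, rfl⟩
  rw [map_map_symm] at h
  exact ⟨σ.symm y, h, σ.apply_symm_apply y⟩

variable (O : ValuationSubring K)

/-- If `σ` preserves `O` then so does `σ⁻¹`. [folklore] -/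
theorem symm_mem_iff {σ : K ≃ₐ[k] K} (hσ : ∀ z : K, σ z ∈ O ↔ z ∈ O) (z : K) :
    σ.symm z ∈ O ↔ z ∈ O := by
  rw [← hσ (σ.symm z), σ.apply_symm_apply]

/-- `σ(loc O T) ≤ loc O (σ T)` for `σ` preserving `O`. [folklore] -/
theorem loc_map_le {σ : K ≃ₐ[k] K} (hσ : ∀ z : K, σ z ∈ O ↔ z ∈ O) (T : Subalgebra k K) :
    (loc O T).map (σ : K →ₐ[k] K) ≤ loc O (T.map (σ : K →ₐ[k] K)) := by
  unfold loc
  rw [AlgHom.map_adjoin]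
  refine Algebra.adjoin_mono ?_
  rintro _ ⟨y, ⟨a, ha, s, hs, hsO, rfl⟩, rfl⟩
  refine ⟨σ a, Subalgebra.mem_map.mpr ⟨a, ha, rfl⟩, σ s, Subalgebra.mem_map.mpr ⟨s, hs, rfl⟩, ?_, ?_⟩
  · rw [← map_inv₀, hσ]
    exact hsO
  · simp [map_mul, map_inv₀]

/-- `σ(nrm T) ≤ nrm (σ T)`. [folklore] -/
theorem nrm_map_le (σ : K ≃ₐ[k] K) (T : Subalgebra k K) :
    (nrm T).map (σ : K →ₐ[k] K) ≤ nrm (T.map (σ : K →ₐ[k] K)) := by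
  unfold nrm
  rw [AlgHom.map_adjoin]
  refine Algebra.adjoin_mono ?_
  rintro _ ⟨y, hy, rfl⟩
  let e : ↥T ≃ₐ[k] ↥(T.map (σ : K →ₐ[k] K)) := σ.subalgebraMap T
  have hcomp : (algebraMap ↥(T.map (σ : K →ₐ[k] K)) K).comp e.toRingEquiv.toRingHom =
      (σ : K →+* K).comp (algebraMap ↥T K) := RingHom.ext fun _ => rfl
  exact IsIntegral.map_of_comp_eq (R := ↥T) e.toRingEquiv.toRingHom (σ : K →+* K) hcomp hy

/-- `σ(chart O T) ≤ chart O (σ T)` for `σ` preserving `O`. [folklore] -/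
theorem chart_map_le {σ : K ≃ₐ[k] K} (hσ : ∀ z : K, σ z ∈ O ↔ z ∈ O) (T : Subalgebra k K) :
    (chart O T).map (σ : K →ₐ[k] K) ≤ chart O (T.map (σ : K →ₐ[k] K)) := by
  unfold chart
  rw [AlgHom.map_adjoin]
  refine Algebra.adjoin_mono ?_
  rintro _ ⟨y, hy | ⟨c, hc, x, hx, hx0, hadm, rfl⟩, rfl⟩
  · exact Or.inl (Subalgebra.mem_map.mpr ⟨y, hy, rfl⟩)
  · refine Or.inr ⟨σ c, ?_, σ x, ?_, ?_, ?_, ?_⟩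
    · rw [ca_map]; exact ⟨c, hc, rfl⟩
    · rw [ca_map]; exact ⟨x, hx, rfl⟩
    · exact (map_ne_zero_iff (σ : K →ₐ[k] K) σ.injective).mpr hx0
    · intro c' hc'
      rw [ca_map] at hc'
      obtain ⟨c₀, hc₀, rfl⟩ := hc'
      rw [← map_inv₀, ← map_mul, hσ]
      exact hadm c₀ hc₀
    · simp [map_mul, map_inv₀]

/-- `σ(loc O (nrm (chart O T))) ≤ loc O (nrm (chart O (σ T)))` — one step of the canonical operator
— for `σ` preserving `O`. [folklore] -/
theorem step_map_le {σ : K ≃ₐ[k] K} (hσ : ∀ z : K, σ z ∈ O ↔ z ∈ O) (T : Subalgebra k K) :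
    (loc O (nrm (chart O T))).map (σ : K →ₐ[k] K) ≤
      loc O (nrm (chart O (T.map (σ : K →ₐ[k] K)))) := by
  refine (loc_map_le O hσ _).trans ?_
  have h : (nrm (chart O T)).map (σ : K →ₐ[k] K) ≤ nrm (chart O (T.map (σ : K →ₐ[k] K))) :=
    (nrm_map_le σ _).trans (by
      unfold nrm
      refine Algebra.adjoin_mono fun y hy => ?_
      exact SyzygyFlattening.isIntegral_of_le (chart_map_le O hσ T) hy)
  unfold loc
  refine Algebra.adjoin_mono ?_
  rintro y ⟨a, ha, s, hs, hsO, rfl⟩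
  exact ⟨a, h ha, s, h hs, hsO, rfl⟩

/-- **The step is `σ`-equivariant**: `σ(loc O (nrm (chart O T))) = loc O (nrm (chart O (σ T)))` for
`σ` preserving `O`. [folklore] -/
theorem step_map {σ : K ≃ₐ[k] K} (hσ : ∀ z : K, σ z ∈ O ↔ z ∈ O) (T : Subalgebra k K) :
    (loc O (nrm (chart O T))).map (σ : K →ₐ[k] K) =
      loc O (nrm (chart O (T.map (σ : K →ₐ[k] K)))) := by
  refine le_antisymm (step_map_le O hσ T) ?_
  have h := step_map_le O (symm_mem_iff O hσ) (T.map (σ : K →ₐ[k] K))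
  rw [map_map_symm] at h
  have h' := Subalgebra.map_mono (f := (σ : K →ₐ[k] K)) h
  rwa [map_symm_map] at h'

/-- **Self-similarity propagates**: if `T_(s+1) = σ(T_s)` then `T_(s+n+1) = σ(T_(s+n))` for all `n`.
[folklore] -/
theorem tower_add_succ {σ : K ≃ₐ[k] K} (hσ : ∀ z : K, σ z ∈ O ↔ z ∈ O) (A : Subalgebra k K)
    (s : ℕ) (h1 : tower O A (s + 1) = (tower O A s).map (σ : K →ₐ[k] K)) (n : ℕ) :
    tower O A (s + n + 1) = (tower O A (s + n)).map (σ : K →ₐ[k] K) := by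
  induction n with
  | zero => simpa using h1
  | succ n ih =>
    rw [show s + (n + 1) + 1 = (s + n + 1) + 1 by ring, tower_succ, ih, ← step_map O hσ,
      ← tower_succ, show s + (n + 1) = s + n + 1 by ring]

/-- **Every later annihilator sits above a base annihilator.** Under self-similarity from the stage
`s` with `σ` preserving `O` and not decreasing values on `O`, every non-zero `y ∈ ca(T_(s+n))` admits
a non-zero `x ∈ ca(T_s)` with `y · x⁻¹ ∈ O`. [folklore] -/
theorem exists_mem_ca_base {σ : K ≃ₐ[k] K} (hσ : ∀ z : K, σ z ∈ O ↔ z ∈ O)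
    (hmono : ∀ z : K, z ∈ O → z ≠ 0 → σ z * z⁻¹ ∈ O) (A : Subalgebra k K)
    (hk : ∀ c : k, algebraMap k K c ∈ O) (hAO : A.toSubring ≤ O.toSubring) (s : ℕ)
    (h1 : tower O A (s + 1) = (tower O A s).map (σ : K →ₐ[k] K)) (n : ℕ) :
    ∀ y ∈ ca (tower O A (s + n)), y ≠ 0 → ∃ x ∈ ca (tower O A s), x ≠ 0 ∧ y * x⁻¹ ∈ O := by
  induction n with
  | zero =>
    intro y hy hy0
    exact ⟨y, by simpa using hy, hy0, by rw [mul_inv_cancel₀ hy0]; exact O.one_mem⟩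
  | succ n ih =>
    intro y hy hy0
    rw [show s + (n + 1) = s + n + 1 by ring, tower_add_succ O hσ A s h1 n, ca_map] at hy
    obtain ⟨y₀, hy₀, rfl⟩ := hy
    have hy₀0 : y₀ ≠ 0 := fun h => hy0 (by rw [h, map_zero])
    obtain ⟨x, hx, hx0, hxO⟩ := ih y₀ hy₀ hy₀0
    refine ⟨x, hx, hx0, ?_⟩
    have hy₀O : y₀ ∈ O :=
      mem_valuationSubring_of_mem_tower O hk hAO (s + n) y₀ (ca_subset _ hy₀)
    have : σ y₀ * x⁻¹ = (σ y₀ * y₀⁻¹) * (y₀ * x⁻¹) := by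
      field_simp
    rw [this]
    exact mul_mem (hmono y₀ hy₀O hy₀0) hxO

end Equivariance

/-! ## 3. The construction modulo which the crux fails, and the negative lemma -/

/-- **Hypothesis `SelfSimilarSeed` — a self-similar seed for the canonical `ca`-tower (the
construction modulo which `StrictDrop` fails; NOT proved, NOT in print, no instance known).** Crux
data `(p, k, K, O, A)` — `k` of characteristic `p` inside the valuation ring `O` of `K`, `A ⊆ O`
finitely generated with `Frac A = K` — together with a `k`-automorphism `σ` of `K` that preserves
`O` (`σ z ∈ O ↔ z ∈ O`) and does not decrease values on `O` (`σ z · z⁻¹ ∈ O` for `0 ≠ z ∈ O`;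
automatic for a DVR), and a stage `s` of the canonical tower (the route's `let`-telescope verbatim)
which is SINGULAR and whose successor is its `σ`-translate: `T_(s+1) = σ(T_s)`. Model: the
chart-isomorphic-to-the-cone loops of normalised Nash blow-ups of toric fourfolds
(Castillo–Duarte–Leyton-Álvarez–Liendo 2024) along an eigen-weight valuation, transposed to the
cohomology annihilator. HYPOTHESIS of this negative lemma (filed `--negative-modulo SelfSimilarSeed`);
deliberately NOT a cited Literature fact. -/
def SelfSimilarSeed : Prop :=
  ∃ (p : ℕ) (_ : p.Prime) (k K : Type) (_ : Field k) (_ : CharP k p) (_ : Field K) (_ : Algebra k K) (O : ValuationSubring K) (A : Subalgebra k K) (σ : K ≃ₐ[k] K), (∀ c : k, algebraMap k K c ∈ O) ∧ A.FG ∧ IsFractionRing ↥A K ∧ A.toSubring ≤ O.toSubring ∧ (∀ z : K, σ z ∈ O ↔ z ∈ O) ∧ (∀ z : K, z ∈ O → z ≠ 0 → σ z * z⁻¹ ∈ O) ∧ let ca : Subalgebra k K → Set K := fun A => {x : K | ∃ hx : x ∈ A, ∃ n : ℕ, ∀ i : ℕ, n ≤ i → ∀ (M N : ModuleCat.{0}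 ↥A), Module.Finite ↥A M → Module.Finite ↥A N → ∀ e : CategoryTheory.Abelian.Ext.{0} M N i, (⟨x, hx⟩ : ↥A) • e = 0}; let loc : Subalgebra k K → Subalgebra k K := fun A => Algebra.adjoin k {y : K | ∃ a ∈ A, ∃ s ∈ A, s⁻¹ ∈ O ∧ y = a * s⁻¹}; let chart : Subalgebra k K → Subalgebra k K := fun A => Algebra.adjoin k ((A : Set K) ∪ {y : K | ∃ c ∈ ca A, ∃ x ∈ ca A, x ≠ 0 ∧ (∀ c' ∈ ca A, c' * x⁻¹ ∈ O) ∧ y = c * x⁻¹}); let nrm : Subalgebra k K → Subalgebra k K := fun B => Algebra.adjoin k {y : K | IsIntegral ↥B y}; let tower : Subalgebra k K → ℕ → Subalgebra k K := fun A m => @Nat.rec (fun _ => Subalgebra k K) (loc A) (fun _ B => loc (nrm (chart B))) m; ∃ s : ℕ, ¬ IsRegularLocalRing ↥(tower A s) ∧ tower A (s + 1) = (tower A s).map (σ : K →ₐ[k] K)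

/-- **`StrictDrop` is false as soon as a self-similar seed exists** (negative lemma, `¬ StrictDrop`
modulo the construction `SelfSimilarSeed`). The crux's drop from the singular stage `s` would
produce a non-zero `y ∈ ca(T_(m'))`, `m' > s`, with `y · x⁻¹ ∉ O` for every non-zero
`x ∈ ca(T_s)` — but by self-similarity (`exists_mem_ca_base`: `ca` is intrinsic and the step is
`σ`-equivariant) there is such an `x` with `y · x⁻¹ ∈ O`. [folklore] -/
theorem StrictDrop_false_of_SelfSimilarSeed : SelfSimilarSeed → ¬ StrictDrop := by
  rintro ⟨p, hp, k, K, _, _, _, _, O, A, σ, hk, hfg, hfrac, hle, hσ, hmono, s, hsing, h1⟩ hD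
  obtain ⟨m', hm', y, hy, hy0, hval⟩ := hD p hp k K O A hk hfg hfrac hle s hsing
  obtain ⟨n, rfl⟩ : ∃ n : ℕ, m' = s + n := ⟨m' - s, by omega⟩
  obtain ⟨x, hx, hx0, hxO⟩ :=
    exists_mem_ca_base O hσ hmono A hk hle s h1 n y hy hy0
  exact hval x hx hx0 hxO

end Summit.ResolutionOfSingularities.ResolutionOfSingularities.Theorems.StrictDrop.Negative.SelfSimilar

end
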